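import Mathlib
import HarnessLib
import Summits.AtomisticToContinuum.FouriersLaw.Theorems.VanishingNoiseTransferVanishingNoiseBoundStubForwardFieldLeakFree
import Summits.AtomisticToContinuum.FouriersLaw.Theorems.VanishingNoiseTransferVanishingNoiseBoundStubForwardFieldPairRadiation
import Summits.AtomisticToContinuum.FouriersLaw.Theorems.VanishingNoiseTransferVanishingNoiseBoundFlipKuboOnsager
import Summits.AtomisticToContinuum.FouriersLaw.Theorems.JunctionLocalitySuperadditiveResistanceStubPlainForwardField

/-!
# `VanishingNoiseBound` — negative-side support: the windowed two-channel stub of line `energy-dipole-leak-coercivity` is FALSE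

Crux `VanishingNoiseTransfer.VanishingNoiseBound` (item stmt-AtomisticToContinuum-11976), line
`energy-dipole-leak-coercivity` (skeleton `Cruxes/VanishingNoiseBound/Lines/energy_dipole_leak_coercivity.lean`).
Its load-bearing stub S1 `stub_windowTwoChannel` — "∃ window radius `ℓ` and `C ≥ 0` such that for every
length `L`, interior bond `i` with window `W = [i−ℓ, i+1+ℓ] ⊆ [1, L−2]`, every `f ∈ L²(μ_T)` and all
`ρ₀, ρ₂ ≥ 0` dominating the `W`-local even LEAK and the `W`-local PAIR RADIATION of `X_H f`:
`(∫ j_i f dμ_T)² ≤ C √(Σ_{x∈W} ‖f∘F_x − f‖²) √(ρ₀ + Σ_{x,y∈W} ρ₂ x y)`" — is refuted here, sorry-free,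
for EVERY admissible parameter set (`windowTwoChannel_false_at`), hence as stated (`windowTwoChannel_false`).

WITNESS: `f = g₀`, the DETERMINISTIC equilibrium forward field of the left bath of the `L`-chain,
`L = 2ℓ + 4` (`L_{T,T} g₀ = −(p_0² − T)`, `g₀ ∈ C^∞`, `|g₀| ≤ C₀ e^{H/4T}` — `exists_plainForwardField_expBound`,
the landed construction `exists_smooth_forwardField` of crux 11748's line with the pointwise weight bound
exported). By the two landed IDENTITY stubs of the same line, taken at flip rate `ε = 0`,
`stub_forwardFieldLeakFree` gives `∫ g₀ X_Hφ dμ_T = 0` for every window-local even test function (so `ρ₀ = 0`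
is admissible) and `stub_forwardFieldPairRadiation` gives `(∫ g₀ X_Hφ dμ_T)² ≤ 2·0²·(…) = 0` for every
two-site odd–odd test function (so `ρ₂ ≡ 0` is admissible): the deterministic corrector is an exactly
leak-free, exactly radiation-free observable in EVERY interior window — its `X_H g₀ = −γ S_B g₀ − (p_0² − T)`
is visible only at the bath sites. S1 then forces `∫ g₀ j_i dμ_T = 0`, whereas the landed bond-response
identity (`helper_flipBondResponseIdentity`, any `ε`) and Kubo positivity (`flipKubo_pos_and_le`, `ε ≥ 0`)
give `∫ g₀ j_i dμ_T = γA − T² < 0`. The same computation shows that NO reshape of S1 keeping (i) hypotheses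
that only see `W`-local projections of `X_H f` for interior `W` and (ii) a right-hand side vanishing when
those projections vanish can hold: the line's composition idea (leak-free field × `O(ε)` local radiation,
rate cancelling) is inconsistent at fixed `N`, where the true corrector dissipates through the baths.

Contents: `exists_plainForwardField_expBound` (deterministic forward field with the `e^{H/4T}` bound, all
`L ≥ 1`); `windowTwoChannel_false_at` (for all parameters `> 0`, `T > 0`: no `ℓ, C` work);
`windowTwoChannel_false` (`¬ S1` verbatim). Nothing here closes the item; it kills the line.
-/

noncomputable section

open MeasureTheory Filter Topology Finset
open scoped ContDiff NNReal
open Literature.MathematicalPhysics.KineticTheory.HeatConduction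
open Literature.MathematicalPhysics.KineticTheory Literature.Analysis.Distribution OscillatorChain
open Summit.AtomisticToContinuum.FouriersLaw.Theorems.SubdiffusiveBondHeat
open Summit.AtomisticToContinuum.FouriersLaw.Theorems.SuperadditiveResistance.PlainForwardField
open Summit.AtomisticToContinuum.FouriersLaw.Theorems.SuperadditiveResistance.DeviceLiouville
  (kin liouvilleOp kin_eq_sq)
open Summit.AtomisticToContinuum.FouriersLaw.Cruxes.SuperadditiveResistance.FloatingProbeBypassLaplacian
  (abs_act_kin_le)

namespace Summit.AtomisticToContinuum.FouriersLaw.Theorems.VanishingNoiseBound.Negative.WindowTwoChannel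

/-! ## The deterministic equilibrium forward field, with its pointwise weight bound -/

section ForwardField

variable {ω₂ lam β γ : ℝ}

/-- **Deterministic equilibrium forward field of the left bath, with the `e^{H/4T}` bound.** For
`pinnedChain ω₂ lam β γ` (`ω₂ > 0`, `lam ≥ 0`, `β, γ > 0`), `T > 0` and every `L ≥ 1` there is a smooth `g`
with `|g| ≤ C₀ e^{H/4T}` pointwise and `L_{T,T} g = −(p_0² − T)` pointwise. This is the landed construction
`exists_smooth_forwardField` (`g₀ = ∫₀^∞ P_t(p_0² − T) dt`, distributional Poisson equation, Hörmander
regularity) with the pointwise domination of `g₀` carried over to its smooth representative: the set where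
the bound holds is closed and co-null for Lebesgue measure, hence everything.
[cite: CuneoEckmannHairerReyBellet2018, Thm 2.13] [cite: Hormander1967, Thm 1.1] -/
theorem exists_plainForwardField_expBound (hω : 0 < ω₂) (hl : 0 ≤ lam) (hβ : 0 < β) (hγ : 0 < γ)
    {L : ℕ} (hL : 0 < L) {T : ℝ} (hT : 0 < T) :
    ∃ g : PhaseSpace L → ℝ, ContDiff ℝ ∞ g ∧
      (∃ C₀ : ℝ, ∀ x, |g x| ≤ C₀ * Real.exp (1 / (4 * T) * (pinnedChain ω₂ lam β γ).hamiltonian L x)) ∧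
      ∀ x, (pinnedChain ω₂ lam β γ).generator L T T g x = -(x.2 ⟨0, hL⟩ ^ 2 - T) := by
  -- adapted from `FloatingProbeBypassLaplacian.exists_smooth_forwardField`
  -- (tree file `…JunctionLocalitySuperadditiveResistanceStubPlainForwardField.lean`), bound exported
  haveI := isAddHaarMeasure_volume_phaseSpace L
  set P := pinnedChain ω₂ lam β γ with hP
  have hU : ContDiff ℝ ∞ P.U := pinnedChain_contDiff_U ω₂ lam β γ
  have hV : ContDiff ℝ ∞ P.V := pinnedChain_contDiff_V ω₂ lam β γ
  have hγ' : P.γ = γ := rfl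
  have hγT : 0 ≤ P.γ * T := by rw [hγ']; positivity
  set ϑ : ℝ := 1 / (4 * T) with hϑ
  have hϑ0 : 0 < ϑ := by positivity
  have hϑ1 : ϑ < 1 / T := by rw [hϑ, div_lt_div_iff₀ (by positivity) hT]; nlinarith
  set K : ℝ := 2 / ϑ + T with hK
  set k : PhaseSpace L → ℝ := fun y => y.2 ⟨0, hL⟩ ^ 2 - T with hk
  have hks : ContDiff ℝ ∞ k := by rw [hk]; fun_prop
  have hkc : Continuous k := hks.continuous
  have hkb : ∀ y, |k y| ≤ K * Real.exp (ϑ * P.hamiltonian L y) := fun y =>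
    abs_sq_momentum_sub_le_exp hω hl hβ.le hϑ0 hT.le y ⟨0, hL⟩
  obtain ⟨M, c, hc, hdecay⟩ := abs_act_kin_le hω hl hβ hγ hL hT
  set Hm := P.hamiltonian L with hHm
  have hHc : Continuous Hm := pinnedChain_continuous_hamiltonian ω₂ lam β γ L
  -- the candidate `g₀ = ∫₀^∞ P_t k dt`
  set g₀ : PhaseSpace L → ℝ := fun x => ∫ t in Set.Ioi (0 : ℝ),
    ∫ y, k y ∂(P.langevinKernel L T T t.toNNReal x) with hg₀
  have hg₀m : StronglyMeasurable g₀ := stronglyMeasurable_forwardIntegral hω hl hβ.le hγ.le hkc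
  set M' : ℝ := M * ∫ t in Set.Ioi (0 : ℝ), Real.exp (-c * t) with hM'
  have hg₀b : ∀ x, |g₀ x| ≤ M' * Real.exp (ϑ * Hm x) := fun x =>
    abs_forwardIntegral_le k hc hdecay x
  set B : PhaseSpace L → ℝ := fun x => M' * Real.exp (ϑ * Hm x) with hB
  have hBc : Continuous B := by rw [hB]; fun_prop
  have hg₀B : ∀ x, ‖g₀ x‖ ≤ ‖B x‖ := fun x => by
    rw [Real.norm_eq_abs, Real.norm_eq_abs]
    exact (hg₀b x).trans (le_abs_self _)
  have hg₀loc : LocallyIntegrable g₀ volume :=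
    hBc.locallyIntegrable.mono hg₀m.aestronglyMeasurable (Eventually.of_forall hg₀B)
  -- the Poisson equation in `𝓓'`
  have hweak₀ : ∀ φ : PhaseSpace L → ℝ, ContDiff ℝ ∞ φ → HasCompactSupport φ →
      ∫ x, g₀ x * hormanderTranspose (P.drift L) (P.bathField hL T T) (fun _ => 0) φ x =
        ∫ x, (-k x) * φ x := by
    intro φ hφ hφc
    have h := integral_transpose_mul_forwardIntegral hω hl hβ.le hγ.le hL hT hϑ0 hϑ1 hc hks hkb hdecay hφ hφc
    calc ∫ x, g₀ x * hormanderTranspose (P.drift L) (P.bathField hL T T) (fun _ => 0) φ x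
        = ∫ x, (sdeGenerator (fun y => -P.drift L y) (P.bathVecL L T) (P.bathVecR L T) φ x +
            2 * γ * φ x) * g₀ x := by
          refine integral_congr_ae (ae_of_all _ fun x => ?_)
          dsimp only
          rw [hormanderTranspose_generatorFamily_eq_revGenerator P hU hV hL hγT hγT hφ x, hγ', mul_comm]
      _ = -∫ x, φ x * k x := h
      _ = ∫ x, (-k x) * φ x := by
          rw [← integral_neg]
          exact integral_congr_ae (ae_of_all _ fun x => by ring)
  -- hypoelliptic regularity
  obtain ⟨g, hg, hae⟩ := exists_smooth_ae_eq_of_weak_poisson hβ.le hγ hL hT hg₀loc hks.neg hweak₀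
  have hweak : ∀ φ : PhaseSpace L → ℝ, ContDiff ℝ ∞ φ → HasCompactSupport φ →
      ∫ x, g x * hormanderTranspose (P.drift L) (P.bathField hL T T) (fun _ => 0) φ x =
        ∫ x, (-k x) * φ x := by
    intro φ hφ hφc
    rw [← hweak₀ φ hφ hφc]
    refine integral_congr_ae ?_
    filter_upwards [hae] with x hx
    rw [hx]
  have hclass : ∀ x, P.generator L T T g x = -k x :=
    generator_eq_of_weak_poisson P hU hV hL hγT hγT hg hkc.neg hweak
  -- the pointwise bound passes to the continuous representative
  have hgb : ∀ x, |g x| ≤ M' * Real.exp (ϑ * Hm x) := by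
    have hclosed : IsClosed {x | |g x| ≤ M' * Real.exp (ϑ * Hm x)} :=
      isClosed_le (continuous_abs.comp hg.continuous) (continuous_const.mul ((hHc.const_smul ϑ).rexp))
    have hae' : ∀ᵐ x ∂(volume : Measure (PhaseSpace L)), |g x| ≤ M' * Real.exp (ϑ * Hm x) := by
      filter_upwards [hae] with x hx
      rw [← hx]
      exact hg₀b x
    have hnull : (volume : Measure (PhaseSpace L)) {x | |g x| ≤ M' * Real.exp (ϑ * Hm x)}ᶜ = 0 := by
      rw [Set.compl_setOf]
      exact ae_iff.1 hae'
    intro x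
    by_contra hx
    have hpos : 0 < (volume : Measure (PhaseSpace L)) {x | |g x| ≤ M' * Real.exp (ϑ * Hm x)}ᶜ :=
      hclosed.isOpen_compl.measure_pos volume ⟨x, hx⟩
    exact hpos.ne' hnull
  exact ⟨g, hg, ⟨M', fun x => by simpa only [hϑ, hHm] using hgb x⟩, hclass⟩

end ForwardField

/-! ## The refutation -/

section Refutation

variable {ω₂ lam β γ : ℝ}

/-- **No window radius and no constant make the two-channel inequality true** (for ANY admissible
parameters): given `ℓ, C ≥ 0`, at `L = 2ℓ + 4`, bond `i = ℓ + 1`, window `[1, 2ℓ + 2]`, the deterministic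
forward field `g₀` of `exists_plainForwardField_expBound` is admissible with `ρ₀ = 0`
(`stub_forwardFieldLeakFree` at `ε = 0`) and `ρ₂ ≡ 0` (`stub_forwardFieldPairRadiation` at `ε = 0`), so the
inequality would give `∫ g₀ j_i dμ_T = 0`; but `∫ g₀ j_i dμ_T = γA − T² < 0` by
`helper_flipBondResponseIdentity` and `flipKubo_pos_and_le` (`ε = 0`). -/
theorem windowTwoChannel_false_at (hω : 0 < ω₂) (hl : 0 < lam) (hβ : 0 < β) (hγ : 0 < γ) {T : ℝ}
    (hT : 0 < T) :
    ¬ ∃ (ℓ : ℕ) (C : ℝ), 0 ≤ C ∧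
        ∀ (L : ℕ) (i : Fin L) (lo hi : ℕ), lo + ℓ = i.val → hi = i.val + 1 + ℓ → 1 ≤ lo → hi + 2 ≤ L →
        ∀ f : PhaseSpace L → ℝ, MemLp f 2 ((pinnedChain ω₂ lam β γ).gibbsMeasure L T) →
        ∀ (ρ₀ : ℝ) (ρ₂ : Fin L → Fin L → ℝ), 0 ≤ ρ₀ → (∀ x y, 0 ≤ ρ₂ x y) →
        (∀ φ : PhaseSpace L → ℝ, ContDiff ℝ ((⊤ : ℕ∞) : WithTop ℕ∞) φ →
          (∀ u v : PhaseSpace L,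
            (∀ k : Fin L, lo ≤ k.val → k.val ≤ hi → u.1 k = v.1 k ∧ u.2 k = v.2 k) → φ u = φ v) →
          (∃ R : ℝ, ∀ u : PhaseSpace L,
            (∃ k : Fin L, lo ≤ k.val ∧ k.val ≤ hi ∧ (R ≤ |u.1 k| ∨ R ≤ |u.2 k|)) → φ u = 0) →
          (∀ (z : Fin L) (u : PhaseSpace L), φ (momentumFlip z u) = φ u) →
          (∫ u, f u * liouvilleOp (pinnedChain ω₂ lam β γ) L φ u
              ∂((pinnedChain ω₂ lam β γ).gibbsMeasure L T)) ^ 2 ≤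
            ρ₀ * ∫ u, φ u ^ 2 ∂((pinnedChain ω₂ lam β γ).gibbsMeasure L T)) →
        (∀ x y : Fin L, lo ≤ x.val → x.val ≤ hi → lo ≤ y.val → y.val ≤ hi →
          ∀ φ : PhaseSpace L → ℝ, ContDiff ℝ ((⊤ : ℕ∞) : WithTop ℕ∞) φ →
          (∀ u v : PhaseSpace L,
            (∀ k : Fin L, (k = x ∨ k = y) → u.1 k = v.1 k ∧ u.2 k = v.2 k) → φ u = φ v) →
          (∃ R : ℝ, ∀ u : PhaseSpace L,
            (R ≤ |u.1 x| ∨ R ≤ |u.2 x| ∨ R ≤ |u.1 y| ∨ R ≤ |u.2 y|) → φ u = 0) →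
          (∀ u, φ (momentumFlip x u) = -φ u) → (∀ u, φ (momentumFlip y u) = -φ u) →
          (∫ u, f u * liouvilleOp (pinnedChain ω₂ lam β γ) L φ u
              ∂((pinnedChain ω₂ lam β γ).gibbsMeasure L T)) ^ 2 ≤
            ρ₂ x y * ∫ u, φ u ^ 2 ∂((pinnedChain ω₂ lam β γ).gibbsMeasure L T)) →
        (∫ u, f u * (pinnedChain ω₂ lam β γ).bondCurrent L i u
            ∂((pinnedChain ω₂ lam β γ).gibbsMeasure L T)) ^ 2 ≤
          C * Real.sqrt (∑ x : Fin L, if lo ≤ x.val ∧ x.val ≤ hi then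
                ∫ u, (f (momentumFlip x u) - f u) ^ 2 ∂((pinnedChain ω₂ lam β γ).gibbsMeasure L T) else 0) *
            Real.sqrt (ρ₀ + ∑ x : Fin L, ∑ y : Fin L,
              if lo ≤ x.val ∧ x.val ≤ hi ∧ lo ≤ y.val ∧ y.val ≤ hi then ρ₂ x y else 0) := by
  rintro ⟨ℓ, C, hC0, H1⟩
  set P := pinnedChain ω₂ lam β γ with hP
  -- the geometry: `L = 2ℓ + 4`, `i = ℓ + 1`, window `[1, 2ℓ + 2]`
  set L : ℕ := 2 * ℓ + 4 with hLdef
  have hL0 : 0 < L := by omega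
  have hL2 : 2 ≤ L := by omega
  set i : Fin L := ⟨ℓ + 1, by omega⟩ with hidef
  have hiL : i.val + 1 < L := by simp [hidef]; omega
  set μ := P.gibbsMeasure L T with hμ
  -- the witness: the deterministic forward field
  obtain ⟨g, hg, ⟨C₀, hgb⟩, hgen⟩ := exists_plainForwardField_expBound hω hl.le hβ hγ hL0 hT
  have hg2 : ContDiff ℝ 2 g := hg.of_le (by norm_cast)
  have hpde : ∀ u, P.flipGenerator L T T 0 g u = -(kin L 0 u - T) := by
    intro u
    rw [OscillatorChain.flipGenerator, hgen u, zero_mul, add_zero, kin_eq_sq hL0]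
  have h14 : 2 * (1 / (4 * T)) < 1 / T := by
    rw [show 2 * (1 / (4 * T)) = 1 / (2 * T) by field_simp; ring, div_lt_div_iff₀ (by positivity) hT]
    nlinarith
  have hgL : MemLp g 2 μ := memLp_two_of_abs_le_exp_hamiltonian hω hl.le hβ.le γ L hT h14 hg.continuous hgb
  -- S1 at `f = g`, `ρ₀ = 0`, `ρ₂ ≡ 0`
  have hleak : ∀ φ : PhaseSpace L → ℝ, ContDiff ℝ ((⊤ : ℕ∞) : WithTop ℕ∞) φ →
      (∀ u v : PhaseSpace L,
        (∀ k : Fin L, 1 ≤ k.val → k.val ≤ i.val + 1 + ℓ → u.1 k = v.1 k ∧ u.2 k = v.2 k) → φ u = φ v) →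
      (∃ R : ℝ, ∀ u : PhaseSpace L,
        (∃ k : Fin L, 1 ≤ k.val ∧ k.val ≤ i.val + 1 + ℓ ∧ (R ≤ |u.1 k| ∨ R ≤ |u.2 k|)) → φ u = 0) →
      (∀ (z : Fin L) (u : PhaseSpace L), φ (momentumFlip z u) = φ u) →
      (∫ u, g u * liouvilleOp P L φ u ∂μ) ^ 2 ≤ 0 * ∫ u, φ u ^ 2 ∂μ := by
    intro φ hφ hdep hvan heven
    have hhi : (i.val + 1 + ℓ) + 2 ≤ L := by simp [hidef]; omega
    have hz : ∫ u, g u * liouvilleOp P L φ u ∂μ = 0 :=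
      stub_forwardFieldLeakFree ω₂ lam β γ hω hl hβ hγ T 0 hT L hL2 g hg2 ⟨C₀, hgb⟩ hpde 1
        (i.val + 1 + ℓ) le_rfl hhi φ hφ hdep hvan heven
    rw [hz]
    simp
  have hpair : ∀ x y : Fin L, 1 ≤ x.val → x.val ≤ i.val + 1 + ℓ → 1 ≤ y.val → y.val ≤ i.val + 1 + ℓ →
      ∀ φ : PhaseSpace L → ℝ, ContDiff ℝ ((⊤ : ℕ∞) : WithTop ℕ∞) φ →
      (∀ u v : PhaseSpace L,
        (∀ k : Fin L, (k = x ∨ k = y) → u.1 k = v.1 k ∧ u.2 k = v.2 k) → φ u = φ v) →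
      (∃ R : ℝ, ∀ u : PhaseSpace L,
        (R ≤ |u.1 x| ∨ R ≤ |u.2 x| ∨ R ≤ |u.1 y| ∨ R ≤ |u.2 y|) → φ u = 0) →
      (∀ u, φ (momentumFlip x u) = -φ u) → (∀ u, φ (momentumFlip y u) = -φ u) →
      (∫ u, g u * liouvilleOp P L φ u ∂μ) ^ 2 ≤ (fun _ _ => (0 : ℝ)) x y * ∫ u, φ u ^ 2 ∂μ := by
    intro x y hx1 hx2 hy1 hy2 φ hφ hdep hvan hox hoy
    have hxL : x.val + 2 ≤ L := by simp [hidef] at hx2; omega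
    have hyL : y.val + 2 ≤ L := by simp [hidef] at hy2; omega
    have h := stub_forwardFieldPairRadiation ω₂ lam β γ hω hl hβ hγ T 0 hT L hL2 g hg2 ⟨C₀, hgb⟩ hpde
      x y hx1 hxL hy1 hyL φ hφ hdep hvan hox hoy
    refine h.trans (le_of_eq ?_)
    simp
  have hmain := H1 L i 1 (i.val + 1 + ℓ) (by simp [hidef]; omega) rfl le_rfl (by simp [hidef]; omega) g hgL
    0 (fun _ _ => 0) le_rfl (fun _ _ => le_rfl) hleak hpair
  -- the right-hand side vanishes
  have hrhs : C * Real.sqrt (∑ x : Fin L, if 1 ≤ x.val ∧ x.val ≤ i.val + 1 + ℓ then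
        ∫ u, (g (momentumFlip x u) - g u) ^ 2 ∂μ else 0) *
      Real.sqrt (0 + ∑ x : Fin L, ∑ y : Fin L,
        if 1 ≤ x.val ∧ x.val ≤ i.val + 1 + ℓ ∧ 1 ≤ y.val ∧ y.val ≤ i.val + 1 + ℓ then
          (fun _ _ => (0 : ℝ)) x y else 0) = 0 := by
    have hS : (∑ x : Fin L, ∑ y : Fin L,
        if 1 ≤ x.val ∧ x.val ≤ i.val + 1 + ℓ ∧ 1 ≤ y.val ∧ y.val ≤ i.val + 1 + ℓ then
          (fun _ _ => (0 : ℝ)) x y else 0) = 0 :=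
      Finset.sum_eq_zero fun x _ => Finset.sum_eq_zero fun y _ => by split_ifs <;> rfl
    rw [hS, add_zero, Real.sqrt_zero, mul_zero]
  rw [hrhs] at hmain
  have hzero : ∫ u, g u * P.bondCurrent L i u ∂μ = 0 := by
    have h0 : (∫ u, g u * P.bondCurrent L i u ∂μ) ^ 2 = 0 := le_antisymm hmain (sq_nonneg _)
    exact pow_eq_zero_iff (two_ne_zero) |>.1 h0
  -- but every bond carries the (negative) response of the deterministic forward field
  have hbond : ∫ u, g u * P.bondCurrent L i u ∂μ = γ * (∫ u, g u * (kin L 0 u - T) ∂μ) - T ^ 2 :=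
    NoisyFourier.FlipCeiling.helper_flipBondResponseIdentity ω₂ lam β γ T 0 hω hl hβ hγ hT L hL2 g hg2
      hgL hpde i hiL
  have hkubo := (flipKubo_pos_and_le hω hl hβ hγ hT le_rfl hL2 hg2 hgL hpde).1
  set A := ∫ u, g u * (kin L 0 u - T) ∂μ with hA
  have hγA : γ * A < T ^ 2 := by
    have h1 : 0 < 1 - γ / T ^ 2 * A := (mul_pos_iff_of_pos_left hγ).1 hkubo
    have hT2 : 0 < T ^ 2 := by positivity
    have h2 : γ / T ^ 2 * A < 1 := by linarith
    have h3 : γ / T ^ 2 * A * T ^ 2 < 1 * T ^ 2 := mul_lt_mul_of_pos_right h2 hT2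
    rw [one_mul, show γ / T ^ 2 * A * T ^ 2 = γ * A by field_simp] at h3
    exact h3
  rw [hzero] at hbond
  linarith

/-- **S1 `stub_windowTwoChannel` of line `energy-dipole-leak-coercivity` is FALSE** — the registered
statement, verbatim, negated; from `windowTwoChannel_false_at` at `pinnedChain 1 1 1 1`, `T = 1`. -/
theorem windowTwoChannel_false :
    ¬ (∀ ω₂ lam β γ : ℝ, 0 < ω₂ → 0 < lam → 0 < β → 0 < γ → ∀ T : ℝ, 0 < T →
      ∃ (ℓ : ℕ) (C : ℝ), 0 ≤ C ∧
        ∀ (L : ℕ) (i : Fin L) (lo hi : ℕ), lo + ℓ = i.val → hi = i.val + 1 + ℓ → 1 ≤ lo → hi + 2 ≤ L →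
        ∀ f : PhaseSpace L → ℝ, MemLp f 2 ((pinnedChain ω₂ lam β γ).gibbsMeasure L T) →
        ∀ (ρ₀ : ℝ) (ρ₂ : Fin L → Fin L → ℝ), 0 ≤ ρ₀ → (∀ x y, 0 ≤ ρ₂ x y) →
        (∀ φ : PhaseSpace L → ℝ, ContDiff ℝ ((⊤ : ℕ∞) : WithTop ℕ∞) φ →
          (∀ u v : PhaseSpace L,
            (∀ k : Fin L, lo ≤ k.val → k.val ≤ hi → u.1 k = v.1 k ∧ u.2 k = v.2 k) → φ u = φ v) →
          (∃ R : ℝ, ∀ u : PhaseSpace L,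
            (∃ k : Fin L, lo ≤ k.val ∧ k.val ≤ hi ∧ (R ≤ |u.1 k| ∨ R ≤ |u.2 k|)) → φ u = 0) →
          (∀ (z : Fin L) (u : PhaseSpace L), φ (momentumFlip z u) = φ u) →
          (∫ u, f u * liouvilleOp (pinnedChain ω₂ lam β γ) L φ u
              ∂((pinnedChain ω₂ lam β γ).gibbsMeasure L T)) ^ 2 ≤
            ρ₀ * ∫ u, φ u ^ 2 ∂((pinnedChain ω₂ lam β γ).gibbsMeasure L T)) →
        (∀ x y : Fin L, lo ≤ x.val → x.val ≤ hi → lo ≤ y.val → y.val ≤ hi →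
          ∀ φ : PhaseSpace L → ℝ, ContDiff ℝ ((⊤ : ℕ∞) : WithTop ℕ∞) φ →
          (∀ u v : PhaseSpace L,
            (∀ k : Fin L, (k = x ∨ k = y) → u.1 k = v.1 k ∧ u.2 k = v.2 k) → φ u = φ v) →
          (∃ R : ℝ, ∀ u : PhaseSpace L,
            (R ≤ |u.1 x| ∨ R ≤ |u.2 x| ∨ R ≤ |u.1 y| ∨ R ≤ |u.2 y|) → φ u = 0) →
          (∀ u, φ (momentumFlip x u) = -φ u) → (∀ u, φ (momentumFlip y u) = -φ u) →
          (∫ u, f u * liouvilleOp (pinnedChain ω₂ lam β γ) L φ u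
              ∂((pinnedChain ω₂ lam β γ).gibbsMeasure L T)) ^ 2 ≤
            ρ₂ x y * ∫ u, φ u ^ 2 ∂((pinnedChain ω₂ lam β γ).gibbsMeasure L T)) →
        (∫ u, f u * (pinnedChain ω₂ lam β γ).bondCurrent L i u
            ∂((pinnedChain ω₂ lam β γ).gibbsMeasure L T)) ^ 2 ≤
          C * Real.sqrt (∑ x : Fin L, if lo ≤ x.val ∧ x.val ≤ hi then
                ∫ u, (f (momentumFlip x u) - f u) ^ 2 ∂((pinnedChain ω₂ lam β γ).gibbsMeasure L T) else 0) *
            Real.sqrt (ρ₀ + ∑ x : Fin L, ∑ y : Fin L,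
              if lo ≤ x.val ∧ x.val ≤ hi ∧ lo ≤ y.val ∧ y.val ≤ hi then ρ₂ x y else 0)) :=
  fun h => windowTwoChannel_false_at (ω₂ := 1) (lam := 1) (β := 1) (γ := 1) one_pos one_pos one_pos one_pos
    (T := 1) one_pos (h 1 1 1 1 one_pos one_pos one_pos one_pos 1 one_pos)

end Refutation

end Summit.AtomisticToContinuum.FouriersLaw.Theorems.VanishingNoiseBound.Negative.WindowTwoChannel

end
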